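import Mathlib
import Summits.NavierStokesRegularity.NavierStokesRegularity.Theorems.FilamentSkeletonRssSelectionBoxRJRungPartnerStrain

/-!
# Route `FilamentSkeletonRss` · crux `SelectionBoxRJ` (stmt-NavierStokesRegularity-21220) — census for clause 12, tools:
# kernel facts, chord geometry of a `C²` filament seen from one of its points, and the two-region majorant

Lane `ns-filament-19175-p1` (g8).  Helper file `--supports stmt-NavierStokesRegularity-21220`; route-independent.  Pointwise
tools for `…RungNormalBlockSelf` (the normal block of the regularised Biot–Savart gradient AT a point of the filament is
a near-rotation), which is the determinant half of clause 12 of the skeleton box: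

* kernel facts for `K_p(r) = ((r² + 1)^{p})⁻¹` (core `1`): `≤ 1`, monotone, `K₃ ≥ 1/3` on `r ≤ 1`, inverse-power bounds;
* geometry of a `C²` unit-speed curve with `‖X″‖ ≤ κ₀` seen from `X c`: tangent turning `κ₀|u − c|`, the chord is within
  `κ₀ (u − c)²` of the tangent line, hence its component along any normal `h ⊥ X′ c` is `≤ κ₀ (u − c)²` and
  `‖X c − X u‖ ≥ |u − c|/2` while `κ₀|u − c| ≤ 1/2`;
* pointwise bounds for the derivative integrand `(−3⟪z, v⟫K₅(z)) • X′u × z + K₃(z) • X′u × v` of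
  `stub_biotSavartDirectionalDeriv` paired with normal vectors: the curvature (`K₅`) term is `≤ 192 κ₀ (1 + s²)⁻¹` and the
  tangent-turning correction of the `K₃` term is `≤ 32 κ₀ (1 + s²)⁻¹` in the near region, everything is under the Cauchy
  majorant `(8/D₁³)(1 + (c₁ s/(D₁ + A₁))²)⁻¹` in the far region (`…RungPartnerStrain.cauchy_majorant_core`); the
  triple-product identities `⟪T × h, l⟫ + ⟪T × l, h⟫ = 0`, `⟪T × h, l⟫ − ⟪T × l, h⟫ = 2⟪T, h × l⟫`;
* the two-region majorant `C_A (1 + (u − c)²)⁻¹ + C_B (1 + (k(u − c))²)⁻¹` and its integral `C_A π + C_B π/k`.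

HONEST FRAMING.  Kernel estimates about a HYPOTHETICAL filament box; nothing here is a claim about Navier–Stokes
regularity or blow-up.
-/

set_option linter.dupNamespace false

noncomputable section

namespace Summit.NavierStokesRegularity.NavierStokesRegularity.Theorems

open Set Function Filter MeasureTheory Real
open Literature.Analysis.FluidPDE
open Summit.NavierStokesRegularity.NavierStokesRegularity.Theorems.SkeletonEquilibrium.Sketch
open scoped InnerProductSpace Topology

namespace SelectionBoxRJRung

/-! ### Kernel facts (core `1`) -/

/-- `((r² + 1)^{p})⁻¹ ≤ 1` and `0 ≤ ((r² + 1)^{p})⁻¹` for `0 ≤ p`. [folklore] -/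
theorem kernel_le_one (r p : ℝ) (hp : 0 ≤ p) : ((r ^ 2 + 1) ^ p)⁻¹ ≤ 1 ∧ 0 ≤ ((r ^ 2 + 1) ^ p)⁻¹ := by
  have h1 : 1 ≤ (r ^ 2 + 1) ^ p := Real.one_le_rpow (by nlinarith [sq_nonneg r]) hp
  exact ⟨inv_le_one_of_one_le₀ h1, inv_nonneg.2 (by positivity)⟩

/-- Monotonicity of the kernels: `0 ≤ r₁ ≤ r₂ ⇒ ((r₂² + 1)^p)⁻¹ ≤ ((r₁² + 1)^p)⁻¹` (`0 ≤ p`). [folklore] -/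
theorem kernel_anti {r₁ r₂ : ℝ} (p : ℝ) (hp : 0 ≤ p) (h0 : 0 ≤ r₁) (h : r₁ ≤ r₂) :
    ((r₂ ^ 2 + 1) ^ p)⁻¹ ≤ ((r₁ ^ 2 + 1) ^ p)⁻¹ := by
  have h1 : (r₁ ^ 2 + 1) ^ p ≤ (r₂ ^ 2 + 1) ^ p :=
    Real.rpow_le_rpow (by positivity) (by nlinarith) hp
  exact inv_anti₀ (by positivity) h1

/-- Near the diagonal the `K₃` kernel is bounded below: `0 ≤ r ≤ 1 ⇒ 1/3 ≤ ((r² + 1)^{3/2})⁻¹`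
(`2^{3/2} = 2√2 < 3`). [folklore] -/
theorem kernel3_ge_third {r : ℝ} (h0 : 0 ≤ r) (h1 : r ≤ 1) : 1 / 3 ≤ ((r ^ 2 + 1) ^ (3 / 2 : ℝ))⁻¹ := by
  have h2 : (r ^ 2 + 1) ^ (3 / 2 : ℝ) ≤ (2 : ℝ) ^ (3 / 2 : ℝ) :=
    Real.rpow_le_rpow (by positivity) (by nlinarith) (by norm_num)
  have h3 : (2 : ℝ) ^ (3 / 2 : ℝ) < 3 := by
    have h4 : ((2 : ℝ) ^ (3 / 2 : ℝ)) ^ 2 = 8 := by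
      rw [← Real.rpow_natCast, ← Real.rpow_mul (by norm_num)]; norm_num
    nlinarith [Real.rpow_nonneg (show (0:ℝ) ≤ 2 by norm_num) (3 / 2 : ℝ)]
  have hpos : 0 < (r ^ 2 + 1) ^ (3 / 2 : ℝ) := by positivity
  rw [one_div]
  exact inv_anti₀ hpos (by linarith)

/-- Inverse-power bounds with core `1`: for `0 < r`, `((r² + 1)^{3/2})⁻¹ ≤ (r³)⁻¹` and `((r² + 1)^{5/2})⁻¹ ≤ (r⁵)⁻¹`.
[folklore] -/
theorem kernel_le_inv_pow {r : ℝ} (hr : 0 < r) :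
    ((r ^ 2 + 1) ^ (3 / 2 : ℝ))⁻¹ ≤ (r ^ 3)⁻¹ ∧ ((r ^ 2 + 1) ^ (5 / 2 : ℝ))⁻¹ ≤ (r ^ 5)⁻¹ := by
  have h := rosenhead_kernel_le_inv_pow hr 1
  simpa only [one_pow] using h

/-! ### Geometry of a `C²` unit-speed curve with curvature `≤ κ₀`, seen from the point `X c` -/

/-- Tangent turning: `‖X′ u − X′ c‖ ≤ κ₀ |u − c|`. [folklore] -/
theorem tangent_sub_le {X : ℝ → EuclideanSpace ℝ (Fin 3)} {κ₀ : ℝ} (hX : ContDiff ℝ 2 X)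
    (hκ : ∀ u, ‖deriv (deriv X) u‖ ≤ κ₀) (c u : ℝ) : ‖deriv X u - deriv X c‖ ≤ κ₀ * |u - c| := by
  have hTd : Differentiable ℝ (deriv X) := hX.differentiable_deriv_two
  have h := Convex.norm_image_sub_le_of_norm_deriv_le (f := deriv X) (fun r _ => hTd r) (fun r _ => hκ r)
    convex_univ (mem_univ c) (mem_univ u)
  simpa using h

/-- The chord deviates quadratically from the tangent line: `‖X u − X c − (u − c) X′ c‖ ≤ κ₀ (u − c)²`. [folklore] -/
theorem chord_sub_tangentLine_le {X : ℝ → EuclideanSpace ℝ (Fin 3)} {κ₀ : ℝ} (hX : ContDiff ℝ 2 X)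
    (hκ : ∀ u, ‖deriv (deriv X) u‖ ≤ κ₀) (c u : ℝ) :
    ‖X u - X c - (u - c) • deriv X c‖ ≤ κ₀ * (u - c) ^ 2 := by
  have hXd : Differentiable ℝ X := hX.differentiable (by norm_num)
  have hκ0 : 0 ≤ κ₀ := (norm_nonneg _).trans (hκ c)
  have hφ : ∀ r, HasDerivAt (fun r => X r - X c - (r - c) • deriv X c) (deriv X r - deriv X c) r := fun r => by
    have h2 : HasDerivAt (fun r : ℝ => (r - c) • deriv X c) ((1 : ℝ) • deriv X c) r :=
      ((hasDerivAt_id' r).sub_const c).smul_const _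
    rw [one_smul] at h2
    exact ((hXd r).hasDerivAt.sub_const _).sub h2
  have hbound : ∀ r ∈ Set.uIcc c u, ‖deriv X r - deriv X c‖ ≤ κ₀ * |u - c| := fun r hr =>
    (tangent_sub_le hX hκ c r).trans (mul_le_mul_of_nonneg_left (Set.abs_sub_left_of_mem_uIcc hr) hκ0)
  have hmvt := (convex_uIcc c u).norm_image_sub_le_of_norm_hasDerivWithin_le
    (fun r _ => (hφ r).hasDerivWithinAt) hbound Set.left_mem_uIcc Set.right_mem_uIcc
  have h0 : X c - X c - (c - c) • deriv X c = 0 := by simp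
  rw [h0, sub_zero, Real.norm_eq_abs] at hmvt
  calc ‖X u - X c - (u - c) • deriv X c‖ ≤ κ₀ * |u - c| * |u - c| := hmvt
    _ = κ₀ * (u - c) ^ 2 := by rw [mul_assoc, abs_mul_abs_self, pow_two]

/-- Unit speed makes the chord `1`-Lipschitz: `‖X c − X u‖ ≤ |u − c|`. [folklore] -/
theorem chord_le {X : ℝ → EuclideanSpace ℝ (Fin 3)} (hX : ContDiff ℝ 2 X) (hunit : ∀ u, ‖deriv X u‖ = 1)
    (c u : ℝ) : ‖X c - X u‖ ≤ |u - c| := by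
  have hXd : Differentiable ℝ X := hX.differentiable (by norm_num)
  have h := Convex.norm_image_sub_le_of_norm_deriv_le (f := X) (C := 1) (fun r _ => hXd r)
    (fun r _ => (hunit r).le) convex_univ (mem_univ u) (mem_univ c)
  rw [one_mul, Real.norm_eq_abs, abs_sub_comm] at h
  exact h

/-- Normal component of the chord: for `h ⊥ X′ c`, `‖h‖ ≤ 1`: `|⟪X c − X u, h⟫| ≤ κ₀ (u − c)²`. [folklore] -/
theorem inner_chord_normal_le {X : ℝ → EuclideanSpace ℝ (Fin 3)} {κ₀ : ℝ} (hX : ContDiff ℝ 2 X)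
    (hκ : ∀ u, ‖deriv (deriv X) u‖ ≤ κ₀) {h : EuclideanSpace ℝ (Fin 3)} (hh : ‖h‖ ≤ 1) {c : ℝ}
    (hht : ⟪h, deriv X c⟫_ℝ = 0) (u : ℝ) : |⟪X c - X u, h⟫_ℝ| ≤ κ₀ * (u - c) ^ 2 := by
  have hid : ⟪X c - X u, h⟫_ℝ = -⟪X u - X c - (u - c) • deriv X c, h⟫_ℝ := by
    rw [inner_sub_left (X u - X c), real_inner_smul_left, real_inner_comm h (deriv X c), hht, mul_zero, sub_zero,
      inner_sub_left, inner_sub_left]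
    ring
  rw [hid, abs_neg]
  calc |⟪X u - X c - (u - c) • deriv X c, h⟫_ℝ| ≤ ‖X u - X c - (u - c) • deriv X c‖ * ‖h‖ :=
        abs_real_inner_le_norm _ _
    _ ≤ κ₀ * (u - c) ^ 2 * 1 :=
        mul_le_mul (chord_sub_tangentLine_le hX hκ c u) hh (norm_nonneg _)
          ((norm_nonneg _).trans (chord_sub_tangentLine_le hX hκ c u))
    _ = κ₀ * (u - c) ^ 2 := mul_one _

/-- Lower chord bound near the base point: if `κ₀ |u − c| ≤ 1/2` then `|u − c|/2 ≤ ‖X c − X u‖`. [folklore] -/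
theorem chord_ge_half {X : ℝ → EuclideanSpace ℝ (Fin 3)} {κ₀ : ℝ} (hX : ContDiff ℝ 2 X)
    (hunit : ∀ u, ‖deriv X u‖ = 1) (hκ : ∀ u, ‖deriv (deriv X) u‖ ≤ κ₀) {c u : ℝ}
    (hs : κ₀ * |u - c| ≤ 1 / 2) : |u - c| / 2 ≤ ‖X c - X u‖ := by
  have h1 := chord_sub_tangentLine_le hX hκ c u
  have h2 : ‖(u - c) • deriv X c‖ = |u - c| := by rw [norm_smul, Real.norm_eq_abs, hunit c, mul_one]
  have h3 : ‖(u - c) • deriv X c‖ - ‖X u - X c - (u - c) • deriv X c‖ ≤ ‖X u - X c‖ := by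
    have h := norm_sub_norm_le ((u - c) • deriv X c) ((u - c) • deriv X c - (X u - X c))
    rw [show (u - c) • deriv X c - ((u - c) • deriv X c - (X u - X c)) = X u - X c by abel,
      show (u - c) • deriv X c - (X u - X c) = -(X u - X c - (u - c) • deriv X c) by abel, norm_neg] at h
    exact h
  have h5 : κ₀ * (u - c) ^ 2 ≤ |u - c| / 2 := by
    have : κ₀ * (u - c) ^ 2 = κ₀ * |u - c| * |u - c| := by rw [mul_assoc, abs_mul_abs_self, pow_two]
    rw [this]
    nlinarith [abs_nonneg (u - c)]
  rw [norm_sub_rev]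
  linarith

/-! ### Pointwise algebra of the derivative integrand -/

/-- Triple-product identities for the `K₃ • X′u × v` part of the gradient: the symmetric pairings vanish and the
antisymmetric one is a triple product — `⟪T × h, l⟫ + ⟪T × l, h⟫ = 0`, `⟪T × n, m⟫ − ⟪T × m, n⟫ = 2⟪T, n × m⟫`. [folklore] -/
theorem cross_pairing_identities (T h l : EuclideanSpace ℝ (Fin 3)) :
    ⟪cross T h, l⟫_ℝ + ⟪cross T l, h⟫_ℝ = 0 ∧ ⟪cross T h, l⟫_ℝ - ⟪cross T l, h⟫_ℝ = 2 * ⟪T, cross h l⟫_ℝ := by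
  constructor <;>
  · simp [cross, crossProduct, PiLp.inner_apply, Fin.sum_univ_three]; ring

/-- `‖n × m‖ ≤ 1` for `‖n‖, ‖m‖ ≤ 1`. [folklore] -/
theorem norm_cross_le_one {n m : EuclideanSpace ℝ (Fin 3)} (hn : ‖n‖ ≤ 1) (hm : ‖m‖ ≤ 1) : ‖cross n m‖ ≤ 1 := by
  calc ‖cross n m‖ ≤ ‖n‖ * ‖m‖ := norm_cross_le_norm_mul_norm n m
    _ ≤ 1 * 1 := mul_le_mul hn hm (norm_nonneg _) zero_le_one
    _ = 1 := one_mul _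

/-- **Region A, curvature (`K₅`) term.**  With `‖T‖ ≤ 1`, `‖l‖ ≤ 1`, `|⟪z, h⟫| ≤ κ₀ s²`, `‖z‖ ≤ |s|`, `|s|/2 ≤ ‖z‖`
(`κ₀ ≥ 0`): `|−3⟪z, h⟫K₅(z) ⟪T × z, l⟫| ≤ 192 κ₀ (1 + s²)⁻¹`. [folklore] -/
theorem gradIntegrand_curv_le {T z h l : EuclideanSpace ℝ (Fin 3)} {s κ₀ : ℝ} (hT : ‖T‖ ≤ 1) (hl : ‖l‖ ≤ 1)
    (hκ : 0 ≤ κ₀) (hzh : |⟪z, h⟫_ℝ| ≤ κ₀ * s ^ 2) (hzle : ‖z‖ ≤ |s|) (hzge : |s| / 2 ≤ ‖z‖) :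
    |(-3 * ⟪z, h⟫_ℝ * ((‖z‖ ^ 2 + 1) ^ (5 / 2 : ℝ))⁻¹) * ⟪cross T z, l⟫_ℝ| ≤ 192 * κ₀ * (1 + s ^ 2)⁻¹ := by
  obtain ⟨hK1, hK0⟩ := kernel_le_one ‖z‖ (5 / 2 : ℝ) (by norm_num)
  have hcz : |⟪cross T z, l⟫_ℝ| ≤ ‖z‖ := by
    calc |⟪cross T z, l⟫_ℝ| ≤ ‖cross T z‖ * ‖l‖ := abs_real_inner_le_norm _ _
      _ ≤ (‖T‖ * ‖z‖) * 1 := mul_le_mul (norm_cross_le_norm_mul_norm T z) hl (norm_nonneg _)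
          ((norm_nonneg _).trans (norm_cross_le_norm_mul_norm T z))
      _ ≤ (1 * ‖z‖) * 1 := by gcongr
      _ = ‖z‖ := by ring
  rw [abs_mul, abs_mul, abs_mul, abs_of_nonneg hK0, show |(-3:ℝ)| = 3 by norm_num]
  have hmain : 3 * |⟪z, h⟫_ℝ| * ((‖z‖ ^ 2 + 1) ^ (5 / 2 : ℝ))⁻¹ * |⟪cross T z, l⟫_ℝ| ≤
      3 * (κ₀ * s ^ 2) * (((‖z‖ ^ 2 + 1) ^ (5 / 2 : ℝ))⁻¹ * ‖z‖) := by
    calc _ = 3 * |⟪z, h⟫_ℝ| * (((‖z‖ ^ 2 + 1) ^ (5 / 2 : ℝ))⁻¹ * |⟪cross T z, l⟫_ℝ|) := by ring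
      _ ≤ _ := by gcongr
  have h1s : 0 < 1 + s ^ 2 := by positivity
  rcases le_or_gt |s| 1 with hs | hs
  · -- `|s| ≤ 1`: `K₅ ‖z‖ ≤ |s| ≤ 1`, `s² ≤ 1`, `1 + s² ≤ 2`
    have hKz : ((‖z‖ ^ 2 + 1) ^ (5 / 2 : ℝ))⁻¹ * ‖z‖ ≤ 1 := by
      calc ((‖z‖ ^ 2 + 1) ^ (5 / 2 : ℝ))⁻¹ * ‖z‖ ≤ 1 * |s| := mul_le_mul hK1 hzle (norm_nonneg _) zero_le_one
        _ ≤ 1 := by rw [one_mul]; exact hs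
    have hs2 : s ^ 2 ≤ 1 := by rw [← sq_abs]; nlinarith [abs_nonneg s]
    have hrhs : 96 * κ₀ ≤ 192 * κ₀ * (1 + s ^ 2)⁻¹ := by
      rw [show 192 * κ₀ * (1 + s ^ 2)⁻¹ = 192 * κ₀ / (1 + s ^ 2) by rw [div_eq_mul_inv], le_div_iff₀ h1s]
      nlinarith
    calc _ ≤ 3 * (κ₀ * s ^ 2) * (((‖z‖ ^ 2 + 1) ^ (5 / 2 : ℝ))⁻¹ * ‖z‖) := hmain
      _ ≤ 3 * (κ₀ * 1) * 1 := by gcongr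
      _ ≤ 96 * κ₀ := by linarith
      _ ≤ _ := hrhs
  · -- `|s| > 1`: `K₅ ≤ ‖z‖⁻⁵`, `‖z‖ ≥ |s|/2`
    have hzpos : 0 < ‖z‖ := lt_of_lt_of_le (by linarith) hzge
    obtain ⟨-, hK5⟩ := kernel_le_inv_pow hzpos
    have hKz : ((‖z‖ ^ 2 + 1) ^ (5 / 2 : ℝ))⁻¹ * ‖z‖ ≤ 16 / s ^ 4 := by
      calc ((‖z‖ ^ 2 + 1) ^ (5 / 2 : ℝ))⁻¹ * ‖z‖ ≤ (‖z‖ ^ 5)⁻¹ * ‖z‖ :=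
            mul_le_mul_of_nonneg_right hK5 (norm_nonneg _)
        _ = (‖z‖ ^ 4)⁻¹ := by field_simp
        _ ≤ ((|s| / 2) ^ 4)⁻¹ :=
            inv_anti₀ (pow_pos (by linarith) 4) (pow_le_pow_left₀ (by positivity) hzge 4)
        _ = 16 / s ^ 4 := by
            rw [div_pow, show |s| ^ 4 = s ^ 4 by rw [show (4:ℕ) = 2 * 2 by norm_num, pow_mul, sq_abs, ← pow_mul]]
            rw [inv_div]; norm_num
    have hs2 : 1 < s ^ 2 := by rw [← sq_abs]; nlinarith
    have hs4 : 0 < s ^ 4 := by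
      have : s ^ 4 = (s ^ 2) ^ 2 := by ring
      rw [this]; positivity
    calc _ ≤ 3 * (κ₀ * s ^ 2) * (((‖z‖ ^ 2 + 1) ^ (5 / 2 : ℝ))⁻¹ * ‖z‖) := hmain
      _ ≤ 3 * (κ₀ * s ^ 2) * (16 / s ^ 4) := by gcongr
      _ = 48 * κ₀ / s ^ 2 := by field_simp; ring
      _ ≤ 192 * κ₀ * (1 + s ^ 2)⁻¹ := by
          rw [show 192 * κ₀ * (1 + s ^ 2)⁻¹ = 192 * κ₀ / (1 + s ^ 2) by rw [div_eq_mul_inv],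
            div_le_div_iff₀ (by positivity) h1s]
          nlinarith

/-- **Region A, turning (`K₃`) correction.**  With `‖T − t‖ ≤ κ₀|s|`, `‖x‖ ≤ 1`, `|σ| ≤ 1`, `|s|/2 ≤ ‖z‖` (`κ₀ ≥ 0`):
`|2 K₃(z) σ ⟪T − t, x⟫| ≤ 32 κ₀ (1 + s²)⁻¹`. [folklore] -/
theorem gradIntegrand_turn_le {T t z x : EuclideanSpace ℝ (Fin 3)} {s κ₀ σ : ℝ} (hTt : ‖T - t‖ ≤ κ₀ * |s|)
    (hx : ‖x‖ ≤ 1) (hσ : |σ| ≤ 1) (hκ : 0 ≤ κ₀) (hzge : |s| / 2 ≤ ‖z‖) :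
    |2 * ((‖z‖ ^ 2 + 1) ^ (3 / 2 : ℝ))⁻¹ * σ * ⟪T - t, x⟫_ℝ| ≤ 32 * κ₀ * (1 + s ^ 2)⁻¹ := by
  obtain ⟨hK1, hK0⟩ := kernel_le_one ‖z‖ (3 / 2 : ℝ) (by norm_num)
  have hin : |⟪T - t, x⟫_ℝ| ≤ κ₀ * |s| := by
    calc |⟪T - t, x⟫_ℝ| ≤ ‖T - t‖ * ‖x‖ := abs_real_inner_le_norm _ _
      _ ≤ κ₀ * |s| * 1 := mul_le_mul hTt hx (norm_nonneg _) ((norm_nonneg _).trans hTt)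
      _ = κ₀ * |s| := mul_one _
  rw [abs_mul, abs_mul, abs_mul, abs_of_nonneg hK0, show |(2:ℝ)| = 2 by norm_num]
  have hmain : 2 * ((‖z‖ ^ 2 + 1) ^ (3 / 2 : ℝ))⁻¹ * |σ| * |⟪T - t, x⟫_ℝ| ≤
      2 * ((‖z‖ ^ 2 + 1) ^ (3 / 2 : ℝ))⁻¹ * 1 * (κ₀ * |s|) := by gcongr
  have h1s : 0 < 1 + s ^ 2 := by positivity
  rcases le_or_gt |s| 1 with hs | hs
  · have hs2 : s ^ 2 ≤ 1 := by rw [← sq_abs]; nlinarith [abs_nonneg s]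
    calc _ ≤ 2 * ((‖z‖ ^ 2 + 1) ^ (3 / 2 : ℝ))⁻¹ * 1 * (κ₀ * |s|) := hmain
      _ ≤ 2 * 1 * 1 * (κ₀ * 1) := by gcongr
      _ = 2 * κ₀ := by ring
      _ ≤ 32 * κ₀ * (1 + s ^ 2)⁻¹ := by
          rw [show 32 * κ₀ * (1 + s ^ 2)⁻¹ = 32 * κ₀ / (1 + s ^ 2) by rw [div_eq_mul_inv], le_div_iff₀ h1s]
          nlinarith
  · have hzpos : 0 < ‖z‖ := lt_of_lt_of_le (by linarith) hzge
    obtain ⟨hK3, -⟩ := kernel_le_inv_pow hzpos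
    have hK : ((‖z‖ ^ 2 + 1) ^ (3 / 2 : ℝ))⁻¹ ≤ 8 / |s| ^ 3 := by
      calc ((‖z‖ ^ 2 + 1) ^ (3 / 2 : ℝ))⁻¹ ≤ (‖z‖ ^ 3)⁻¹ := hK3
        _ ≤ ((|s| / 2) ^ 3)⁻¹ := inv_anti₀ (by positivity) (pow_le_pow_left₀ (by positivity) hzge 3)
        _ = 8 / |s| ^ 3 := by rw [div_pow, inv_div]; norm_num
    have hs0 : 0 < |s| := by linarith
    have hs2 : 1 < s ^ 2 := by rw [← sq_abs]; nlinarith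
    calc _ ≤ 2 * ((‖z‖ ^ 2 + 1) ^ (3 / 2 : ℝ))⁻¹ * 1 * (κ₀ * |s|) := hmain
      _ ≤ 2 * (8 / |s| ^ 3) * 1 * (κ₀ * |s|) := by gcongr
      _ = 16 * κ₀ / |s| ^ 2 := by field_simp; ring
      _ = 16 * κ₀ / s ^ 2 := by rw [sq_abs]
      _ ≤ 32 * κ₀ * (1 + s ^ 2)⁻¹ := by
          rw [show 32 * κ₀ * (1 + s ^ 2)⁻¹ = 32 * κ₀ / (1 + s ^ 2) by rw [div_eq_mul_inv],
            div_le_div_iff₀ (by positivity) h1s]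
          nlinarith

/-- **Region B (far from the base point), Cauchy majorant.**  If `‖T‖ ≤ 1`, `D₁ ≤ ‖z‖` and
`c₁|s| − A₁ ≤ ‖z‖` (`c₁, D₁ > 0`, `A₁ ≥ 0`), then `‖z‖⁻³ ≤ (2/D₁³)(1 + (c₁ s/(D₁ + A₁))²)⁻¹`; hence the whole
derivative integrand has norm `≤ (8‖v‖/D₁³)(1 + (c₁ s/(D₁ + A₁))²)⁻¹` and `K₃(z) ≤ (2/D₁³)(1 + (c₁ s/(D₁ + A₁))²)⁻¹`.
[folklore] -/
theorem gradIntegrand_far_le {T z v : EuclideanSpace ℝ (Fin 3)} {s c₁ D₁ A₁ : ℝ} (hT : ‖T‖ ≤ 1) (hc₁ : 0 < c₁)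
    (hD₁ : 0 < D₁) (hA₁ : 0 ≤ A₁) (hfar : D₁ ≤ ‖z‖) (hesc : c₁ * |s| - A₁ ≤ ‖z‖) :
    (‖z‖ ^ 3)⁻¹ ≤ 2 / D₁ ^ 3 * (1 + (c₁ * s / (D₁ + A₁)) ^ 2)⁻¹ ∧
    ‖(-3 * ⟪z, v⟫_ℝ * ((‖z‖ ^ 2 + 1) ^ (5 / 2 : ℝ))⁻¹) • cross T z + ((‖z‖ ^ 2 + 1) ^ (3 / 2 : ℝ))⁻¹ • cross T v‖ ≤
      8 * ‖v‖ / D₁ ^ 3 * (1 + (c₁ * s / (D₁ + A₁)) ^ 2)⁻¹ ∧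
    ((‖z‖ ^ 2 + 1) ^ (3 / 2 : ℝ))⁻¹ ≤ 2 / D₁ ^ 3 * (1 + (c₁ * s / (D₁ + A₁)) ^ 2)⁻¹ := by
  have hzpos : 0 < ‖z‖ := lt_of_lt_of_le hD₁ hfar
  have hcore := cauchy_majorant_core (u := s) (u₀ := 0) hD₁ hA₁ hc₁ hfar (by simpa using hesc)
  rw [sub_zero] at hcore
  have hq : 0 < 1 + (c₁ * s / (D₁ + A₁)) ^ 2 := by positivity
  have hcube : (‖z‖ ^ 3)⁻¹ ≤ 2 / D₁ ^ 3 * (1 + (c₁ * s / (D₁ + A₁)) ^ 2)⁻¹ := by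
    rw [show 2 / D₁ ^ 3 * (1 + (c₁ * s / (D₁ + A₁)) ^ 2)⁻¹ = 2 / (D₁ ^ 3 * (1 + (c₁ * s / (D₁ + A₁)) ^ 2)) by
      rw [div_mul_eq_div_div, div_eq_mul_inv (2 / D₁ ^ 3)]]
    rw [inv_eq_one_div, div_le_div_iff₀ (by positivity) (by positivity)]
    -- `D³ (1 + q) ≤ 2 ‖z‖³`: from `D² (1 + q) ≤ 2 ‖z‖²` and `D ≤ ‖z‖`
    have h1 : D₁ ^ 3 * (1 + (c₁ * s / (D₁ + A₁)) ^ 2) = D₁ * (D₁ ^ 2 * (1 + (c₁ * s / (D₁ + A₁)) ^ 2)) := by ring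
    rw [one_mul, h1]
    calc D₁ * (D₁ ^ 2 * (1 + (c₁ * s / (D₁ + A₁)) ^ 2)) ≤ ‖z‖ * (2 * ‖z‖ ^ 2) :=
          mul_le_mul hfar hcore (by positivity) (norm_nonneg _)
      _ = 2 * ‖z‖ ^ 3 := by ring
  have h1 := biotSavart_gradIntegrand_norm_le 1 (v := v) hT hzpos
  simp only [one_pow] at h1
  obtain ⟨hK3, -⟩ := kernel_le_inv_pow hzpos
  refine ⟨hcube, h1.trans ?_, hK3.trans hcube⟩
  calc 4 * ‖v‖ / ‖z‖ ^ 3 = 4 * ‖v‖ * (‖z‖ ^ 3)⁻¹ := by rw [div_eq_mul_inv]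
    _ ≤ 4 * ‖v‖ * (2 / D₁ ^ 3 * (1 + (c₁ * s / (D₁ + A₁)) ^ 2)⁻¹) :=
        mul_le_mul_of_nonneg_left hcube (by positivity)
    _ = 8 * ‖v‖ / D₁ ^ 3 * (1 + (c₁ * s / (D₁ + A₁)) ^ 2)⁻¹ := by ring

/-! ### The two-region majorant and its integral -/

/-- Integral of the two-region majorant `C_A (1 + (u − c)²)⁻¹ + C_B (1 + (k(u − c))²)⁻¹` (`k > 0`):
integrable, with integral `C_A π + C_B π/k`. [folklore] -/
theorem twoRegion_majorant_integral (c CA CB : ℝ) {k : ℝ} (hk : 0 < k) :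
    Integrable (fun u : ℝ => CA * (1 + (u - c) ^ 2)⁻¹ + CB * (1 + (k * (u - c)) ^ 2)⁻¹) ∧
    ∫ u : ℝ, (CA * (1 + (u - c) ^ 2)⁻¹ + CB * (1 + (k * (u - c)) ^ 2)⁻¹) = CA * Real.pi + CB * (Real.pi / k) := by
  have hA : Integrable (fun u : ℝ => (1 + (u - c) ^ 2)⁻¹) := integrable_inv_one_add_sq.comp_sub_right c
  have hB0 : Integrable (fun u : ℝ => (1 + (k * u) ^ 2)⁻¹) := integrable_inv_one_add_sq.comp_mul_left' hk.ne'
  have hB : Integrable (fun u : ℝ => (1 + (k * (u - c)) ^ 2)⁻¹) := hB0.comp_sub_right c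
  have hAv : ∫ u : ℝ, (1 + (u - c) ^ 2)⁻¹ = Real.pi := by
    rw [integral_sub_right_eq_self (fun u : ℝ => (1 + u ^ 2)⁻¹) c, integral_univ_inv_one_add_sq]
  have hBv : ∫ u : ℝ, (1 + (k * (u - c)) ^ 2)⁻¹ = Real.pi / k := by
    rw [integral_sub_right_eq_self (fun u : ℝ => (1 + (k * u) ^ 2)⁻¹) c,
      Measure.integral_comp_mul_left (fun y : ℝ => (1 + y ^ 2)⁻¹), integral_univ_inv_one_add_sq, smul_eq_mul,
      abs_of_pos (inv_pos.2 hk)]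
    ring
  refine ⟨(hA.const_mul CA).add (hB.const_mul CB), ?_⟩
  rw [integral_add (hA.const_mul CA) (hB.const_mul CB), integral_const_mul, integral_const_mul, hAv, hBv]

/-- Pointwise domination by the two-region majorant: if a real quantity is `≤ a (1 + s²)⁻¹` whenever `|s| ≤ S₁` and
`≤ b (1 + (k s)²)⁻¹` whenever `S₁ ≤ |s|` (`a, b ≥ 0`), it is `≤ a (1 + s²)⁻¹ + b (1 + (k s)²)⁻¹`. [folklore] -/
theorem twoRegion_dominate {q s S₁ a b k : ℝ} (ha : 0 ≤ a) (hb : 0 ≤ b)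
    (hAreg : |s| ≤ S₁ → q ≤ a * (1 + s ^ 2)⁻¹) (hBreg : S₁ ≤ |s| → q ≤ b * (1 + (k * s) ^ 2)⁻¹) :
    q ≤ a * (1 + s ^ 2)⁻¹ + b * (1 + (k * s) ^ 2)⁻¹ := by
  have h1 : 0 ≤ a * (1 + s ^ 2)⁻¹ := by positivity
  have h2 : 0 ≤ b * (1 + (k * s) ^ 2)⁻¹ := by positivity
  rcases le_total |s| S₁ with hs | hs
  · linarith [hAreg hs]
  · linarith [hBreg hs]

end SelectionBoxRJRung

end Summit.NavierStokesRegularity.NavierStokesRegularity.Theorems
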